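import Summits.CriticalPhenomena.PercolationContinuityZ3.Theorems.PercNearOneGluingNoHeavyLowerTailSahiMixtureHMixFour

/-!
# The HEREDITARY mixture conjecture is false at six events — an exact counterexample to the generic three-slot cell GC(3)
# (kernel statement modulo the finite hereditary check of the explicit law)

Support file of the one-cut programme (crux `NoHeavyLowerTail`, stmt-CriticalPhenomena-4575; cell `prim-masterthm`, seat P3, gen 6;
`run/shared/lean/prim/prim-masterthm/prim-masterthm-p3/HIERARCHY.md` §13 UPDATE 3; evidence `HMIX-COUNTEREXAMPLE-n6.md` on the item).

THE LAW (`cex6Weight`, this seat; found by SLSQP on the generic cell of `…SahiMixtureGenericCellThree`, then symmetrised and rounded to denominator 500).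
Pattern space `{0,1,2}^3`, `s_j` = level of the nested pair `P_j ⊆ Q_j`; masses `/500`: `38` on `(0,0,0)` and on each pattern with one `1` and two `0`; `2` on each
pattern with two `1` and one `0`; `71` on each pattern with two `2` and one `0`; `5` on each pattern with two `2` and one `1`; `114` on `(2,2,2)`; `0` elsewhere
(14 atoms).  Events `Q_j = {s_j ≥ 1}` ⊇ `P_j = {s_j = 2}`; moments `μP_j = 133/250`, `μP_jP_k = 19/50`, `μP_0P_1P_2 = 57/250`, `μQ_j = 313/500`, `μQ_jQ_k = 101/250`,
`μQ_0Q_1Q_2 = 129/500` (`cex6_moments`).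
* **`sahiE_three_mixEv_cex6`**: OR-ing a fair coin into `P_0, P_1, P_2`, the members `B_j = Q_j ∩ (P_j ∪ H) = mixEv P_j Q_j` of the ∩-closed family of the mixed
  events have `E_3(B_0,B_1,B_2) = −799461/10⁹ < 0` (generic-cell identity `sahiE_three_mixEv_eq`; independently recomputed on the 28-point product space).
* **`not_genericCellThree_of_hereditary_cex6`**, **`not_hereditaryMixturePositivity_of_hereditary_cex6`**: hence, GIVEN that the six-member family
  `(Q_0,Q_1,Q_2,P_0,P_1,P_2)` is hereditarily all-orders positive under `cex6Weight`, both `GenericCellThree` and `HereditaryMixturePositivity` (n = 6,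
  F = {P_0,P_1,P_2}, slots `K = ({Q_0,P_0},{Q_1,P_1},{Q_2,P_2})`) are FALSE.
THE HYPOTHESIS is a finite exact computation: by `hereditaryAllOrders_of_irredundant` it is the nonnegativity of the 18 113 irredundant rows (orders ≤ 6) of the
six events, verified in exact rational arithmetic outside the kernel (minimum `1387/15625000 = E_3(P_0,P_1,P_2) > 0`; seat scripts `code-g6/verify_gc3.py`,
`gc3_sym_search.py`; ttrl cp-mix STEP 0 requested l.989) — its kernel discharge (a reflective `native_decide` computation) is left to a computational seat.
The law is also co-hereditary and positively associated on `{0,1,2}^3` (all 980² pairs of up-sets): no law-level class short of product-measure realisability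
separates it from Boolean models.  CONSEQUENCE: the law-level route to OR(∞) through 𝒦 is dead at `(n,|F|) = (6,3)`; H-MIX(4) is untouched (cp-mix H2: all minima
0) and `hereditaryMixture_four_of_cells` should be read with its n=4-specific three-slot cells; nothing at the comb / product-measure level is affected (were the
law the pattern law of increasing events of a product measure, Sahi's `C_3` would fail).  HONEST FRAMING: a conditional refutation (negative lemma); the
condition is decidable and has been decided outside the kernel. [this work]
-/

noncomputable section

open scoped Classical

namespace Summit.CriticalPhenomena.PercolationContinuityZ3.Theorems

open Finset Function
open Literature.Combinatorics.Sahi2008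
open Literature.Probability.Percolation.DecisionTree (ind ind_of_mem ind_of_not_mem ind_nonneg)

namespace SahiMixture

/-! ### The law and the six events -/

/-- The counterexample weight on 14 atoms, in the order `(000); (001),(010),(100); (011),(101),(110); (022),(202),(220); (122),(212),(221); (222)` of
patterns `(s_0,s_1,s_2)`: masses `(38; 38,38,38; 2,2,2; 71,71,71; 5,5,5; 114)/500`. [this work] -/
def cex6Weight : Fin 14 → ℝ :=
  ![19/250, 19/250, 19/250, 19/250, 1/250, 1/250, 1/250, 71/500, 71/500, 71/500, 1/100, 1/100, 1/100, 57/250]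

/-- The outer events `Q_j = {s_j ≥ 1}`. [this work] -/
def cex6Q : Fin 3 → Set (Fin 14) :=
  ![{c | c = 3 ∨ c = 5 ∨ c = 6 ∨ c = 8 ∨ c = 9 ∨ c = 10 ∨ c = 11 ∨ c = 12 ∨ c = 13},
    {c | c = 2 ∨ c = 4 ∨ c = 6 ∨ c = 7 ∨ c = 9 ∨ c = 10 ∨ c = 11 ∨ c = 12 ∨ c = 13},
    {c | c = 1 ∨ c = 4 ∨ c = 5 ∨ c = 7 ∨ c = 8 ∨ c = 10 ∨ c = 11 ∨ c = 12 ∨ c = 13}]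

/-- The inner events `P_j = {s_j = 2}` (`P_j ⊆ Q_j`). [this work] -/
def cex6P : Fin 3 → Set (Fin 14) :=
  ![{c | c = 8 ∨ c = 9 ∨ c = 11 ∨ c = 12 ∨ c = 13}, {c | c = 7 ∨ c = 9 ∨ c = 10 ∨ c = 12 ∨ c = 13}, {c | c = 7 ∨ c = 8 ∨ c = 10 ∨ c = 11 ∨ c = 13}]

/-- The six-member family `(Q_0, Q_1, Q_2, P_0, P_1, P_2)`. [this work] -/
def cex6A : Fin 6 → Set (Fin 14) := ![cex6Q 0, cex6Q 1, cex6Q 2, cex6P 0, cex6P 1, cex6P 2]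

/-- Indicator vectors of the six events. [this work] -/
theorem ind_cex6 :
    ind (cex6Q 0) = ![0, 0, 0, 1, 0, 1, 1, 0, 1, 1, 1, 1, 1, 1] ∧ ind (cex6Q 1) = ![0, 0, 1, 0, 1, 0, 1, 1, 0, 1, 1, 1, 1, 1] ∧
    ind (cex6Q 2) = ![0, 1, 0, 0, 1, 1, 0, 1, 1, 0, 1, 1, 1, 1] ∧ ind (cex6P 0) = ![0, 0, 0, 0, 0, 0, 0, 0, 1, 1, 0, 1, 1, 1] ∧
    ind (cex6P 1) = ![0, 0, 0, 0, 0, 0, 0, 1, 0, 1, 1, 0, 1, 1] ∧ ind (cex6P 2) = ![0, 0, 0, 0, 0, 0, 0, 1, 1, 0, 1, 1, 0, 1] := by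
  refine ⟨?_, ?_, ?_, ?_, ?_, ?_⟩ <;> (funext c; fin_cases c <;> simp [cex6Q, cex6P, ind_of_mem, ind_of_not_mem])

/-- The counterexample weight is nonnegative. [this work] -/
theorem cex6Weight_nonneg (c : Fin 14) : 0 ≤ cex6Weight c := by
  fin_cases c <;> norm_num [cex6Weight]

/-- The counterexample weight has total mass `1`. [this work] -/
theorem sum_cex6Weight : ∑ c, cex6Weight c = 1 := by
  simp [cex6Weight, Fin.sum_univ_succ]; norm_num

/-- `P_j ⊆ Q_j`. [this work] -/
theorem cex6P_subset_Q (j : Fin 3) : cex6P j ⊆ cex6Q j := by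
  fin_cases j <;> (intro c hc; fin_cases c <;> simp [cex6P, cex6Q] at hc ⊢)

/-- The fourteen moments of the two triples `P`, `Q`. [this work] -/
theorem cex6_moments :
    ex cex6Weight (ind (cex6P 0)) = 133/250 ∧ ex cex6Weight (ind (cex6P 1)) = 133/250 ∧ ex cex6Weight (ind (cex6P 2)) = 133/250 ∧
    ex cex6Weight (ind (cex6P 0) * ind (cex6P 1)) = 19/50 ∧ ex cex6Weight (ind (cex6P 0) * ind (cex6P 2)) = 19/50 ∧
    ex cex6Weight (ind (cex6P 1) * ind (cex6P 2)) = 19/50 ∧ ex cex6Weight (ind (cex6P 0) * ind (cex6P 1) * ind (cex6P 2)) = 57/250 ∧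
    ex cex6Weight (ind (cex6Q 0)) = 313/500 ∧ ex cex6Weight (ind (cex6Q 1)) = 313/500 ∧ ex cex6Weight (ind (cex6Q 2)) = 313/500 ∧
    ex cex6Weight (ind (cex6Q 0) * ind (cex6Q 1)) = 101/250 ∧ ex cex6Weight (ind (cex6Q 0) * ind (cex6Q 2)) = 101/250 ∧
    ex cex6Weight (ind (cex6Q 1) * ind (cex6Q 2)) = 101/250 ∧ ex cex6Weight (ind (cex6Q 0) * ind (cex6Q 1) * ind (cex6Q 2)) = 129/500 := by
  obtain ⟨q0, q1, q2, p0, p1, p2⟩ := ind_cex6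
  simp only [ex_def, q0, q1, q2, p0, p1, p2, cex6Weight, Fin.sum_univ_succ, Fin.sum_univ_zero, Pi.mul_apply]
  simp; norm_num

/-! ### The negative row of the mixed family -/

/-- **OR-ing a fair coin into `P_0, P_1, P_2`: the cubic row of the mixed members `B_j = P_j ∪ (H ∩ Q_j)` is `−799461/10⁹ < 0`.** [this work] -/
theorem sahiE_three_mixEv_cex6 :
    sahiE (coinWeight cex6Weight (1/2 : ℝ)) 3 ![ind (mixEv (cex6P 0) (cex6Q 0)), ind (mixEv (cex6P 1) (cex6Q 1)), ind (mixEv (cex6P 2) (cex6Q 2))]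
      = -799461/1000000000 := by
  obtain ⟨p0, p1, p2, p01, p02, p12, p012, q0, q1, q2, q01, q02, q12, q012⟩ := cex6_moments
  rw [sahiE_three_mixEv_eq, sahiE_three, sahiE_three, p0, p1, p2, p01, p02, p12, p012, q0, q1, q2, q01, q02, q12, q012]
  norm_num

/-- **GC(3) fails on the counterexample**, given the (externally verified, finite) hereditary positivity of its six events. [this work] -/
theorem not_genericCellThree_of_hereditary_cex6
    (hher : HereditaryAllOrders cex6Weight ![cex6P 0, cex6P 1, cex6P 2, cex6Q 0, cex6Q 1, cex6Q 2]) : ¬ GenericCellThree := by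
  intro hGC
  have h := hGC (Fin 14) cex6Weight cex6Weight_nonneg sum_cex6Weight (cex6P 0) (cex6P 1) (cex6P 2) (cex6Q 0) (cex6Q 1) (cex6Q 2)
    (cex6P_subset_Q 0) (cex6P_subset_Q 1) (cex6P_subset_Q 2) hher
  have hnn := h.nonneg (h := (1/2 : ℝ)) (by norm_num) (by norm_num)
  rw [sahiE_three_mixEv_cex6] at hnn
  norm_num at hnn

/-- The three H-MIX slots `K_j = {Q_j, P_j}` of the family `cex6A` with the coin OR-ed into the `P`'s are the `mixEv P_j Q_j`. [this work] -/
theorem cex6_slots_eq :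
    (fun j => ind (⋂ i ∈ (![({0, 3} : Finset (Fin 6)), {1, 4}, {2, 5}] : Fin 3 → Finset (Fin 6)) j,
        orCoin (cex6A i) ((![false, false, false, true, true, true] : Fin 6 → Bool) i)))
      = ![ind (mixEv (cex6P 0) (cex6Q 0)), ind (mixEv (cex6P 1) (cex6Q 1)), ind (mixEv (cex6P 2) (cex6Q 2))] := by
  have hPQ : ∀ j : Fin 3, cex6Q j ∩ cex6P j = cex6P j := fun j => Set.inter_eq_right.2 (cex6P_subset_Q j)
  funext j
  fin_cases j
  · show ind (⋂ i ∈ ({0, 3} : Finset (Fin 6)), orCoin (cex6A i) ((![false, false, false, true, true, true] : Fin 6 → Bool) i)) = _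
    rw [biInter_orCoin_eq_mixEv]
    have h1 : (⋂ i ∈ ({0, 3} : Finset (Fin 6)), cex6A i) = cex6P 0 := by
      rw [Finset.set_biInter_insert, Finset.set_biInter_singleton]; exact hPQ 0
    have h2 : (⋂ i ∈ ({0, 3} : Finset (Fin 6)).filter (fun i => (![false, false, false, true, true, true] : Fin 6 → Bool) i = false), cex6A i)
        = cex6Q 0 := by
      have : ({0, 3} : Finset (Fin 6)).filter (fun i => (![false, false, false, true, true, true] : Fin 6 → Bool) i = false) = {0} := by decide
      rw [this, Finset.set_biInter_singleton]; rfl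
    rw [h1, h2]; rfl
  · show ind (⋂ i ∈ ({1, 4} : Finset (Fin 6)), orCoin (cex6A i) ((![false, false, false, true, true, true] : Fin 6 → Bool) i)) = _
    rw [biInter_orCoin_eq_mixEv]
    have h1 : (⋂ i ∈ ({1, 4} : Finset (Fin 6)), cex6A i) = cex6P 1 := by
      rw [Finset.set_biInter_insert, Finset.set_biInter_singleton]; exact hPQ 1
    have h2 : (⋂ i ∈ ({1, 4} : Finset (Fin 6)).filter (fun i => (![false, false, false, true, true, true] : Fin 6 → Bool) i = false), cex6A i)
        = cex6Q 1 := by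
      have : ({1, 4} : Finset (Fin 6)).filter (fun i => (![false, false, false, true, true, true] : Fin 6 → Bool) i = false) = {1} := by decide
      rw [this, Finset.set_biInter_singleton]; rfl
    rw [h1, h2]; rfl
  · show ind (⋂ i ∈ ({2, 5} : Finset (Fin 6)), orCoin (cex6A i) ((![false, false, false, true, true, true] : Fin 6 → Bool) i)) = _
    rw [biInter_orCoin_eq_mixEv]
    have h1 : (⋂ i ∈ ({2, 5} : Finset (Fin 6)), cex6A i) = cex6P 2 := by
      rw [Finset.set_biInter_insert, Finset.set_biInter_singleton]; exact hPQ 2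
    have h2 : (⋂ i ∈ ({2, 5} : Finset (Fin 6)).filter (fun i => (![false, false, false, true, true, true] : Fin 6 → Bool) i = false), cex6A i)
        = cex6Q 2 := by
      have : ({2, 5} : Finset (Fin 6)).filter (fun i => (![false, false, false, true, true, true] : Fin 6 → Bool) i = false) = {2} := by decide
      rw [this, Finset.set_biInter_singleton]; rfl
    rw [h1, h2]; rfl

/-- **H-MIX fails at six events on the counterexample**, given the (externally verified, finite) hereditary positivity of the six-member family
`cex6A = (Q_0,Q_1,Q_2,P_0,P_1,P_2)`: with `F = {P_0,P_1,P_2}` and slots `K = ({Q_0,P_0},{Q_1,P_1},{Q_2,P_2})` the conjectured Bernstein positivity would make the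
mixed cubic row nonnegative at `h = 1/2`, but it is `−799461/10⁹`. [this work] -/
theorem not_hereditaryMixturePositivity_of_hereditary_cex6 (hher : HereditaryAllOrders cex6Weight cex6A) : ¬ HereditaryMixturePositivity := by
  intro hmix
  have h := hmix (Fin 14) cex6Weight cex6Weight_nonneg sum_cex6Weight 6 cex6A ![false, false, false, true, true, true] hher 3
    ![({0, 3} : Finset (Fin 6)), {1, 4}, {2, 5}]
  have hnn := h.nonneg (h := (1/2 : ℝ)) (by norm_num) (by norm_num)
  rw [cex6_slots_eq, sahiE_three_mixEv_cex6] at hnn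
  norm_num at hnn

end SahiMixture

end Summit.CriticalPhenomena.PercolationContinuityZ3.Theorems

end
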